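import Literature.AnabelianGeometry.EtaleTheta.Discharge.Sec2OrbitEmbeddingUnitTransport
import Literature.AnabelianGeometry.EtaleTheta.Discharge.Sec2Cor28iInnerOfEmbedding
import HarnessLib

/-!
# [EtTh] Cor 2.8 (i) at an orbit embedding, for an ARBITRARY automorphism `Γ` of `Π^tp_C` restricting to `Π^tp_X`:
# all four conclusions of `Cor28_i` modulo UNIT-FREE theta rigidity; the unit-carrying transport as a twist (proof-only)

S. Mochizuki, *The étale theta function and its Frobenioid-theoretic manifestations* [EtTh], Publ. RIMS **45**
(2009), §2, Cor 2.8 (i) PRIMS PDF p.42 («The isomorphism `γ` preserves the property that `η̈^{Θ,ℤ×μ₂}` … be of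
standard type — a property that determines this collection of classes up to multiplication by a root of unity of
order `l` (resp. 1; l; 1)»; proof: «Theorem 1.10 (i) and the definitions»), Prop 2.4 p.38, Def 2.7 p.41, Thm 1.6
(ii)/(iii) p.24 (bib key `MochizukiEtTh2009`).

PROOF-ONLY companion (0 `def`, 0 `instance`, no new `Prop`; cell abc-iut, layer L2, seat abc-iut-L2-t1 gen 12 —
abc-iut-L2-lead R1354/R1358, VNEXT note N-C28I-2, sequel «F3» of this seat's `Sec2OrbitEmbeddingUnitTransport` (F1);
every input BY NAME).  abc-iut-w6-d049 / abc-iut-w6-d051 proved the four conclusions of abc-iut-L2-t2's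
`ThetaOrbitData.Cor28_i` at `ofEmbedding ε hC hS` for the conjugations `γ_x`, `x ∈ Π^tp_C`
(`ofEmbedding_cor28_i_outer(_reduced)`), modulo P-C5.  `Cor28_i` quantifies over ALL topological automorphisms
`Γ` of `Π^tp_C`; THIS FILE treats an ARBITRARY `Γ` RESTRICTING to `Π^tp_X` through `ι` (`ι ∘ α = Γ ∘ ι`, Prop 2.4)
with a companion `β` on `(Π^tp_X)^Θ` (`β ∘ toTheta = toTheta ∘ α`, Thm 1.6 (ii)):
* §1 the engine `stab_of_map_ι_eq_comm` and the stabilities of `(α, β)` READ OFF `Cor28_i`'s own binders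
  (`Γ(Π^tp_Ÿ) = Π^tp_Ÿ`, the tower stabilities, `InducesOnTheta Γ Γ_Θ`);
* §2 the three collections `η̈^{Θ,ℤ×μ₂}`, `η̈^{Θ,l·ℤ×μ₂}`, `η̲̈^{Θ,l·ℤ×μ₂}` are carried ONTO THEMSELVES by `(Γ, Γ_Θ)`
  modulo the UNIT-FREE rigidity identity `autMap α⁻¹ β⁻¹ η̈^Θ = σ₀·η̈^Θ` (`σ₀ ∈ Π^tp_{X̲̲}`);
* §3 **`ofEmbedding_cor28_i_of_comm`**, **`ofEmbedding_cor28_i_of_comm_reduced`** — ALL FOUR conclusions of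
  `Cor28_i` for such `Γ` (standard type preserved; `EqUpToRootOfUnity l / 1 / 1`, indeed exactly, `κ = 1`): the
  residual displayed beyond `Cor28_i`'s own binders is the compatible pair `(α, β)`, `ι(Π^tp_{X̲}) = T.tp T.PiXu`,
  and the unit-free rigidity identity — the one-binder shape of abc-iut-L2-lead R1354 (c);
* §4 `ofEmbedding_transport_etaZMu2_eq_twist_of_unit` — under UNIT-CARRYING rigidity
  `autMap α⁻¹ β⁻¹ η̈^Θ = [f_k]·(σ₀·η̈^Θ)` (`[f_k]` `Π^tp_X`-invariant, e.g. the Kummer class of a unit — Thm 1.6 (iii))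
  the transported `η̈^{Θ,ℤ×μ₂}` is the TWIST (`ThetaOrbitData.twist`) of `η̈^{Θ,ℤ×μ₂}` by the transported representative;
  whether that twist is «by a root of unity of order 1» is then a question about the class `[f_k]` alone (at the
  cusped inversion model it is NOT absorbed for `[f_k] = κ(−1)`: abc-iut-f-151's `conj_etaDdχ_eq_self_of_mem_GtpY`).
HONEST FRAMING: [EtTh] is refereed; statements about the TYPED interface only (generic over an `OrbitEmbedding`);
the rigidity identities, the pair `(α, β)` and `Cor28_i`'s binders stay in hypothesis position and are NOT asserted;
the ∀-closure of `Cor28_i` over the interface is refuted (abc-iut-w4-d051's `not_forall_cor28_i`); no side is taken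
on [IUTchIII] Cor 3.12; typed ≠ proved.
-/

noncomputable section

namespace Literature.AnabelianGeometry.EtaleTheta

open Literature.AnabelianGeometry.SemiGraphs ThetaCovers Literature.IUT.HodgeArakelov

universe u

namespace ThetaSetting.EtaleThetaData.DoubleUnderline.OrbitEmbedding

variable {p : ℕ} [Fact p.Prime] {D : ThetaSetting p} {E : D.EtaleThetaData} {l : ℕ}
  {C : E.DoubleUnderline l} {T : TemperedCoverData.{u} l} (ε : C.OrbitEmbedding T)
  {Γ : T.Gtp ≃ₜ* T.Gtp} {α : D.PiTemp ≃ₜ* D.PiTemp} {β : D.GtpTheta ≃ₜ* D.GtpTheta}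

/-! ## §1. The stability binders of the pair `(α, β)` from `Γ`-stabilities (the engine for arbitrary `Γ`) -/

omit [Fact p.Prime] in
/-- A `Γ`-STABLE subgroup `H'` of `Π^tp_C` (`Γ(H') = H'`): `y ∈ H' ↔ Γ y ∈ H'`. [cite: MochizukiEtTh2009, Cor 2.8(i) p.42] -/
theorem mem_iff_of_map_eq_comm {l : ℕ} {T : TemperedCoverData.{u} l} {Γ : T.Gtp ≃ₜ* T.Gtp} {H' : Subgroup T.Gtp}
    (h : H'.map Γ.toMulEquiv.toMonoidHom = H') (y : T.Gtp) : y ∈ H' ↔ Γ y ∈ H' := by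
  refine ⟨fun hy => h.le ⟨y, hy, rfl⟩, fun hy => ?_⟩
  obtain ⟨y', hy', hyy⟩ := h.ge hy
  have : y' = y := Γ.injective hyy
  exact this ▸ hy'

/-- **The engine** for a compatible pair: if `ι(H) = H'` and `Γ(H') = H'` then `α(H) ⊆ H` and `α⁻¹(H) ⊆ H`.
[cite: MochizukiEtTh2009, Cor 2.8(i) p.42] -/
theorem stab_of_map_ι_eq_comm (hα : ∀ g, ε.ι (α g) = Γ (ε.ι g)) {H : Subgroup D.PiTemp}
    {H' : Subgroup T.Gtp} (hH : H.map ε.ι = H') (hnorm : ∀ y, y ∈ H' ↔ Γ y ∈ H') :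
    (∀ g, g ∈ H → α g ∈ H) ∧ (∀ g, g ∈ H → α.symm g ∈ H) := by
  have key : ∀ g : D.PiTemp, ε.ι g ∈ H' → g ∈ H := fun g hg => by
    obtain ⟨g', hg', hgg⟩ := hH.ge hg
    exact ε.injective_ι hgg ▸ hg'
  refine ⟨fun g hg => key _ ?_, fun g hg => key _ ?_⟩
  · rw [hα]
    exact (hnorm _).1 (hH.le ⟨g, hg, rfl⟩)
  · rw [ε.ι_symm_eq_of_comm hα]
    refine (hnorm _).2 ?_
    rw [ContinuousMulEquiv.apply_symm_apply]
    exact hH.le ⟨g, hg, rfl⟩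

/-- `α^{±1}(Π^tp_Ÿ) ⊆ Π^tp_Ÿ` from `Γ(Π^tp_Ÿ) = Π^tp_Ÿ` (of `T`). [cite: MochizukiEtTh2009, Cor 2.8(i) p.42] -/
theorem stab_GtpYdd_of_comm (hα : ∀ g, ε.ι (α g) = Γ (ε.ι g))
    (hYmap : T.PiYddtp.map Γ.toMulEquiv.toMonoidHom = T.PiYddtp) :
    (∀ g, g ∈ D.GtpYdd → α g ∈ D.GtpYdd) ∧ (∀ g, g ∈ D.GtpYdd → α.symm g ∈ D.GtpYdd) :=
  ε.stab_of_map_ι_eq_comm hα ε.map_GtpYdd (mem_iff_of_map_eq_comm hYmap)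

/-- `α^{±1}(Π^tp_{X̲̲}) ⊆ Π^tp_{X̲̲}` from the tower stability `Γ(Π^tp_{X̲̲}) = Π^tp_{X̲̲}` (of `T`).
[cite: MochizukiEtTh2009, Cor 2.8(i) p.42] -/
theorem stab_Huu_of_comm (hα : ∀ g, ε.ι (α g) = Γ (ε.ι g))
    (hXuumap : (T.tp T.PiXuu).map Γ.toMulEquiv.toMonoidHom = T.tp T.PiXuu) :
    (∀ g, g ∈ C.Huu → α g ∈ C.Huu) ∧ (∀ g, g ∈ C.Huu → α.symm g ∈ C.Huu) :=
  ε.stab_of_map_ι_eq_comm hα ε.map_Huu (mem_iff_of_map_eq_comm hXuumap)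

/-- `α^{±1}(Π^tp_{X̲}) ⊆ Π^tp_{X̲}` from the tower stability `Γ(Π^tp_{X̲}) = Π^tp_{X̲}` (of `T`), under the
identification `ι(Π^tp_{X̲}) = T.tp T.PiXu`. [cite: MochizukiEtTh2009, Cor 2.8(i) p.42] -/
theorem stab_GtpXu_of_comm (hXuι : (D.GtpXu l).map ε.ι = T.tp T.PiXu) (hα : ∀ g, ε.ι (α g) = Γ (ε.ι g))
    (hXumap : (T.tp T.PiXu).map Γ.toMulEquiv.toMonoidHom = T.tp T.PiXu) :
    (∀ g, g ∈ D.GtpXu l → α g ∈ D.GtpXu l) ∧ (∀ g, g ∈ D.GtpXu l → α.symm g ∈ D.GtpXu l) :=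
  ε.stab_of_map_ι_eq_comm hα hXuι (mem_iff_of_map_eq_comm hXumap)

/-- **`β^{±1}(Δ_Θ) ⊆ Δ_Θ` from `InducesOnTheta Γ Γ_Θ`** and the pair equations (`toTheta` surjective).
[cite: MochizukiEtTh2009, Cor 2.8(i) p.42] -/
theorem stab_DeltaTheta_of_induces_comm (hC : D.Compat) (hS : D.Sec2Hyps)
    (hα : ∀ g, ε.ι (α g) = Γ (ε.ι g)) (hβ : ∀ g, β (D.toTheta g) = D.toTheta (α g))
    {ΓΘ : (ThetaOrbitData.ofEmbedding ε hC hS).DeltaTheta ≃* (ThetaOrbitData.ofEmbedding ε hC hS).DeltaTheta}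
    (hind : (ThetaOrbitData.ofEmbedding ε hC hS).InducesOnTheta Γ ΓΘ) :
    (∀ a, a ∈ D.DeltaTheta → β a ∈ D.DeltaTheta) ∧ (∀ a, a ∈ D.DeltaTheta → β.symm a ∈ D.DeltaTheta) := by
  obtain ⟨hΓ, -⟩ := hind
  obtain ⟨h₁, h₂⟩ := ε.stab_of_map_ι_eq_comm hα (H := D.DeltaTheta.comap D.toTheta) (H' := ε.top) rfl
    (mem_iff_of_map_eq_comm hΓ)
  refine ⟨fun a ha => ?_, fun a ha => ?_⟩
  · obtain ⟨g, rfl⟩ := D.toTheta_surjective a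
    rw [hβ]
    exact h₁ g ha
  · obtain ⟨g, rfl⟩ := D.toTheta_surjective a
    rw [symm_toTheta_eq hβ]
    exact h₂ g ha

omit [Fact p.Prime] in
/-- `Γ` stabilises `T.PiYddtp` and `Γ^{±1}` stabilise `Π^tp_{Ÿ̲̲}` as soon as the binders `hY`, `hYuu` of `Cor28_i` hold
(membership forms). [cite: MochizukiEtTh2009, Cor 2.8(i) p.42] -/
theorem mem_of_binders_comm {l : ℕ} {T : TemperedCoverData.{u} l} {Γ : T.Gtp ≃ₜ* T.Gtp}
    (hYmap : T.PiYddtp.map Γ.toMulEquiv.toMonoidHom = T.PiYddtp)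
    (hYuu : (T.PiYddtp ⊓ T.tp T.PiXuu).map Γ.toMulEquiv.toMonoidHom = T.PiYddtp ⊓ T.tp T.PiXuu) :
    (∀ y : ↥T.PiYddtp, Γ (y : T.Gtp) ∈ T.PiYddtp) ∧
    (∀ g : ↥(T.PiYddtp ⊓ T.tp T.PiXuu), Γ (g : T.Gtp) ∈ T.PiYddtp ⊓ T.tp T.PiXuu) ∧
    (∀ g : ↥(T.PiYddtp ⊓ T.tp T.PiXuu), Γ.symm (g : T.Gtp) ∈ T.PiYddtp ⊓ T.tp T.PiXuu) := by
  refine ⟨fun y => (mem_iff_of_map_eq_comm hYmap _).1 y.2, fun g => (mem_iff_of_map_eq_comm hYuu _).1 g.2,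
    fun g => (mem_iff_of_map_eq_comm hYuu _).2 ?_⟩
  rw [ContinuousMulEquiv.apply_symm_apply]
  exact g.2

/-! ## §2. The three collections are carried onto themselves (unit-free rigidity), for arbitrary `Γ` -/

/-- `(Γ, Γ_Θ) · η̈^{Θ,ℤ×μ₂} = η̈^{Θ,ℤ×μ₂}` for an arbitrary compatible pair, modulo the unit-free rigidity identity
`autMap α⁻¹ β⁻¹ η̈^Θ = σ₀·η̈^Θ` (any `σ₀ ∈ Π^tp_X`). [cite: MochizukiEtTh2009, Def 2.7 p.41] -/
theorem ofEmbedding_transport_etaZMu2_of_comm (hC : D.Compat) (hS : D.Sec2Hyps)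
    (hα : ∀ g, ε.ι (α g) = Γ (ε.ι g)) (hβ : ∀ g, β (D.toTheta g) = D.toTheta (α g))
    (hΔ : ∀ a, a ∈ D.DeltaTheta → β a ∈ D.DeltaTheta) (hΔ' : ∀ a, a ∈ D.DeltaTheta → β.symm a ∈ D.DeltaTheta)
    (hY : ∀ g, g ∈ D.GtpYdd → α g ∈ D.GtpYdd) (hY' : ∀ g, g ∈ D.GtpYdd → α.symm g ∈ D.GtpYdd)
    (ΓΘ : (ThetaOrbitData.ofEmbedding ε hC hS).DeltaTheta ≃* (ThetaOrbitData.ofEmbedding ε hC hS).DeltaTheta)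
    (hind : (ThetaOrbitData.ofEmbedding ε hC hS).InducesOnTheta Γ ΓΘ)
    (hYmap : T.PiYddtp.map Γ.toMulEquiv.toMonoidHom = T.PiYddtp)
    {σ₀ : D.PiTemp}
    (hη : haveI := hC.GtpYdd_normal
      ContH1Aut.autMap D.toTheta D.DeltaTheta α.symm β.symm (symm_toTheta_eq hβ) hΔ'
          (H := D.GtpYdd) (H' := D.GtpYdd) hY E.etaDd =
        ContH1.conj D.toTheta D.DeltaTheta σ₀ E.etaDd) :
    (ThetaOrbitData.ofEmbedding ε hC hS).transport _ Γ hYmap ΓΘ (ThetaOrbitData.ofEmbedding ε hC hS).etaZMu2 =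
      (ThetaOrbitData.ofEmbedding ε hC hS).etaZMu2 := by
  haveI := hC.GtpYdd_normal
  haveI : ε.bot.Normal := ε.normal_bot
  have hΘ := ε.symm_coeffOf_of_induces_comm hC hS hα hβ hΔ' ΓΘ hind
  exact ε.image_orbitColl_eq_of_comm hC hα hβ hΔ hΔ' hY hY' ΓΘ hΘ (ε.mem_PiYddtp_of_comm hα hY) hη
    (S := Set.univ) (fun _ _ => Set.mem_univ _) (fun _ _ => Set.mem_univ _)

/-- `(Γ, Γ_Θ) · η̈^{Θ,l·ℤ×μ₂} = η̈^{Θ,l·ℤ×μ₂}` for an arbitrary compatible pair (`α^{±1}` stabilising `Π^tp_{X̲}`,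
`σ₀ ∈ Π^tp_{X̲}`), modulo unit-free rigidity. [cite: MochizukiEtTh2009, Def 2.7 p.41] -/
theorem ofEmbedding_transport_etaLZMu2_of_comm (hC : D.Compat) (hS : D.Sec2Hyps)
    (hα : ∀ g, ε.ι (α g) = Γ (ε.ι g)) (hβ : ∀ g, β (D.toTheta g) = D.toTheta (α g))
    (hΔ : ∀ a, a ∈ D.DeltaTheta → β a ∈ D.DeltaTheta) (hΔ' : ∀ a, a ∈ D.DeltaTheta → β.symm a ∈ D.DeltaTheta)
    (hY : ∀ g, g ∈ D.GtpYdd → α g ∈ D.GtpYdd) (hY' : ∀ g, g ∈ D.GtpYdd → α.symm g ∈ D.GtpYdd)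
    (hXu : ∀ g, g ∈ D.GtpXu l → α g ∈ D.GtpXu l) (hXu' : ∀ g, g ∈ D.GtpXu l → α.symm g ∈ D.GtpXu l)
    (ΓΘ : (ThetaOrbitData.ofEmbedding ε hC hS).DeltaTheta ≃* (ThetaOrbitData.ofEmbedding ε hC hS).DeltaTheta)
    (hind : (ThetaOrbitData.ofEmbedding ε hC hS).InducesOnTheta Γ ΓΘ)
    (hYmap : T.PiYddtp.map Γ.toMulEquiv.toMonoidHom = T.PiYddtp)
    {σ₀ : D.PiTemp} (hσ₀ : σ₀ ∈ D.GtpXu l)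
    (hη : haveI := hC.GtpYdd_normal
      ContH1Aut.autMap D.toTheta D.DeltaTheta α.symm β.symm (symm_toTheta_eq hβ) hΔ'
          (H := D.GtpYdd) (H' := D.GtpYdd) hY E.etaDd =
        ContH1.conj D.toTheta D.DeltaTheta σ₀ E.etaDd) :
    (ThetaOrbitData.ofEmbedding ε hC hS).transport _ Γ hYmap ΓΘ (ThetaOrbitData.ofEmbedding ε hC hS).etaLZMu2 =
      (ThetaOrbitData.ofEmbedding ε hC hS).etaLZMu2 := by
  haveI := hC.GtpYdd_normal
  haveI : ε.bot.Normal := ε.normal_bot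
  have hΘ := ε.symm_coeffOf_of_induces_comm hC hS hα hβ hΔ' ΓΘ hind
  exact ε.image_orbitColl_eq_of_comm hC hα hβ hΔ hΔ' hY hY' ΓΘ hΘ (ε.mem_PiYddtp_of_comm hα hY) hη
    (S := (D.GtpXu l : Set D.PiTemp))
    (fun s hs => (D.GtpXu l).mul_mem (hXu' s hs) hσ₀)
    (fun s hs => hXu _ ((D.GtpXu l).mul_mem hs ((D.GtpXu l).inv_mem hσ₀)))

/-- `(Γ, Γ_Θ) · η̲̈^{Θ,l·ℤ×μ₂} = η̲̈^{Θ,l·ℤ×μ₂}` for an arbitrary compatible pair (`α^{±1}` stabilising `Π^tp_{X̲̲}`,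
`σ₀ ∈ Π^tp_{X̲̲}`), modulo unit-free rigidity. [cite: MochizukiEtTh2009, Def 2.7 p.41] -/
theorem ofEmbedding_transport_rootLZMu2_of_comm (hC : D.Compat) (hS : D.Sec2Hyps)
    (hα : ∀ g, ε.ι (α g) = Γ (ε.ι g)) (hβ : ∀ g, β (D.toTheta g) = D.toTheta (α g))
    (hΔ : ∀ a, a ∈ D.DeltaTheta → β a ∈ D.DeltaTheta) (hΔ' : ∀ a, a ∈ D.DeltaTheta → β.symm a ∈ D.DeltaTheta)
    (hY : ∀ g, g ∈ D.GtpYdd → α g ∈ D.GtpYdd) (hY' : ∀ g, g ∈ D.GtpYdd → α.symm g ∈ D.GtpYdd)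
    (hU : ∀ g, g ∈ C.Huu → α g ∈ C.Huu) (hU' : ∀ g, g ∈ C.Huu → α.symm g ∈ C.Huu)
    (ΓΘ : (ThetaOrbitData.ofEmbedding ε hC hS).DeltaTheta ≃* (ThetaOrbitData.ofEmbedding ε hC hS).DeltaTheta)
    (hind : (ThetaOrbitData.ofEmbedding ε hC hS).InducesOnTheta Γ ΓΘ)
    (hYuu : (T.PiYddtp ⊓ T.tp T.PiXuu).map Γ.toMulEquiv.toMonoidHom = T.PiYddtp ⊓ T.tp T.PiXuu)
    {σ₀ : D.PiTemp} (hσ₀ : σ₀ ∈ C.Huu)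
    (hη : haveI := hC.GtpYdd_normal
      ContH1Aut.autMap D.toTheta D.DeltaTheta α.symm β.symm (symm_toTheta_eq hβ) hΔ'
          (H := D.GtpYdd) (H' := D.GtpYdd) hY E.etaDd =
        ContH1.conj D.toTheta D.DeltaTheta σ₀ E.etaDd) :
    (ThetaOrbitData.ofEmbedding ε hC hS).transport _ Γ hYuu ΓΘ (ThetaOrbitData.ofEmbedding ε hC hS).rootLZMu2 =
      (ThetaOrbitData.ofEmbedding ε hC hS).rootLZMu2 := by
  haveI := hC.GtpYdd_normal
  haveI : ε.bot.Normal := ε.normal_bot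
  have hΘ := ε.symm_coeffOf_of_induces_comm hC hS hα hβ hΔ' ΓΘ hind
  exact ε.image_rootColl_eq_of_comm hC hα hβ hΔ hΔ' hY hY' ΓΘ hΘ (ε.mem_PiYddtp_of_comm hα hY)
    (ε.mem_PiYdduu_of_comm hα hY hU) (ε.symm_mem_PiYdduu_of_comm hα hY' hU') hη (S := (C.Huu : Set D.PiTemp))
    (fun s hs => C.Huu.mul_mem (hU' s hs) hσ₀)
    (fun s hs => hU _ (C.Huu.mul_mem hs (C.Huu.inv_mem hσ₀)))

/-! ## §3. All four conclusions of `Cor28_i` at `ofEmbedding`, for an ARBITRARY compatible `Γ` -/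

/-- **Cor 2.8 (i) for an ARBITRARY automorphism `Γ` of `Π^tp_C` restricting to `Π^tp_X` through `ι`, modulo
UNIT-FREE theta rigidity**: for a compatible pair `(α, β)` (`ι ∘ α = Γ ∘ ι`, `β ∘ toTheta = toTheta ∘ α`) stabilising
`Π^tp_Ÿ`, `Π^tp_{X̲}`, `Π^tp_{X̲̲}`, `Δ_Θ`, and `Γ_Θ` induced by `Γ`, ALL FOUR conclusions of `ThetaOrbitData.Cor28_i` hold
at `ofEmbedding ε hC hS` — standard type is preserved and the three collections agree with their transports up to a
root of unity of order `l`, `1`, `1` (indeed EXACTLY, `κ = 1`) — PROVIDED `autMap α⁻¹ β⁻¹ η̈^Θ = σ₀·η̈^Θ` with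
`σ₀ ∈ Π^tp_{X̲̲}` (the form of abc-iut-w6-d049's `ofEmbedding_cor28_i_outer` beyond conjugations).
[cite: MochizukiEtTh2009, Cor 2.8(i) p.42] -/
theorem ofEmbedding_cor28_i_of_comm (hC : D.Compat) (hS : D.Sec2Hyps)
    (hstd : (ThetaOrbitData.ofEmbedding ε hC hS).IsStandard)
    (hα : ∀ g, ε.ι (α g) = Γ (ε.ι g)) (hβ : ∀ g, β (D.toTheta g) = D.toTheta (α g))
    (hΔ : ∀ a, a ∈ D.DeltaTheta → β a ∈ D.DeltaTheta) (hΔ' : ∀ a, a ∈ D.DeltaTheta → β.symm a ∈ D.DeltaTheta)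
    (hY : ∀ g, g ∈ D.GtpYdd → α g ∈ D.GtpYdd) (hY' : ∀ g, g ∈ D.GtpYdd → α.symm g ∈ D.GtpYdd)
    (hXu : ∀ g, g ∈ D.GtpXu l → α g ∈ D.GtpXu l) (hXu' : ∀ g, g ∈ D.GtpXu l → α.symm g ∈ D.GtpXu l)
    (hU : ∀ g, g ∈ C.Huu → α g ∈ C.Huu) (hU' : ∀ g, g ∈ C.Huu → α.symm g ∈ C.Huu)
    (ΓΘ : (ThetaOrbitData.ofEmbedding ε hC hS).DeltaTheta ≃* (ThetaOrbitData.ofEmbedding ε hC hS).DeltaTheta)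
    (hind : (ThetaOrbitData.ofEmbedding ε hC hS).InducesOnTheta Γ ΓΘ)
    (hYmap : T.PiYddtp.map Γ.toMulEquiv.toMonoidHom = T.PiYddtp)
    (hYuu : (T.PiYddtp ⊓ T.tp T.PiXuu).map Γ.toMulEquiv.toMonoidHom = T.PiYddtp ⊓ T.tp T.PiXuu)
    {σ₀ : D.PiTemp} (hσ₀ : σ₀ ∈ C.Huu)
    (hη : haveI := hC.GtpYdd_normal
      ContH1Aut.autMap D.toTheta D.DeltaTheta α.symm β.symm (symm_toTheta_eq hβ) hΔ'
          (H := D.GtpYdd) (H' := D.GtpYdd) hY E.etaDd =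
        ContH1.conj D.toTheta D.DeltaTheta σ₀ E.etaDd) :
    (ThetaOrbitData.ofEmbedding ε hC hS).IsStandardColl
        ((ThetaOrbitData.ofEmbedding ε hC hS).transport _ Γ hYmap ΓΘ (ThetaOrbitData.ofEmbedding ε hC hS).etaZMu2) ∧
      (ThetaOrbitData.ofEmbedding ε hC hS).EqUpToRootOfUnity l _ (ThetaOrbitData.ofEmbedding ε hC hS).rootLZMu2
        ((ThetaOrbitData.ofEmbedding ε hC hS).transport _ Γ hYuu ΓΘ (ThetaOrbitData.ofEmbedding ε hC hS).rootLZMu2) ∧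
      (ThetaOrbitData.ofEmbedding ε hC hS).EqUpToRootOfUnity 1 _ (ThetaOrbitData.ofEmbedding ε hC hS).etaZMu2
        ((ThetaOrbitData.ofEmbedding ε hC hS).transport _ Γ hYmap ΓΘ (ThetaOrbitData.ofEmbedding ε hC hS).etaZMu2) ∧
      (ThetaOrbitData.ofEmbedding ε hC hS).EqUpToRootOfUnity 1 _ (ThetaOrbitData.ofEmbedding ε hC hS).etaLZMu2
        ((ThetaOrbitData.ofEmbedding ε hC hS).transport _ Γ hYmap ΓΘ
          (ThetaOrbitData.ofEmbedding ε hC hS).etaLZMu2) := by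
  rw [ε.ofEmbedding_transport_etaZMu2_of_comm hC hS hα hβ hΔ hΔ' hY hY' ΓΘ hind hYmap hη,
    ε.ofEmbedding_transport_rootLZMu2_of_comm hC hS hα hβ hΔ hΔ' hY hY' hU hU' ΓΘ hind hYuu hσ₀ hη,
    ε.ofEmbedding_transport_etaLZMu2_of_comm hC hS hα hβ hΔ hΔ' hY hY' hXu hXu' ΓΘ hind hYmap
      (C.Huu_le_GtpXu hσ₀) hη]
  exact ⟨hstd, ThetaOrbitData.eqUpToRootOfUnity_refl _ _ _ _, ThetaOrbitData.eqUpToRootOfUnity_refl _ _ _ _,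
    ThetaOrbitData.eqUpToRootOfUnity_refl _ _ _ _⟩

/-- **Cor 2.8 (i) for an ARBITRARY `Γ`, binder-REDUCED**: the stabilities of `(α, β)` are read off `Cor28_i`'s own
binders (`Γ(Π^tp_Ÿ) = Π^tp_Ÿ`, `Γ(Π^tp_{Ÿ̲̲}) = Π^tp_{Ÿ̲̲}`, the tower stabilities `Γ(Π^tp_{X̲̲}) = Π^tp_{X̲̲}`,
`Γ(Π^tp_{X̲}) = Π^tp_{X̲}`, and `InducesOnTheta Γ Γ_Θ`); what remains displayed is the compatible pair `(α, β)`
(Prop 2.4: `Γ` restricts to `Π^tp_X`; Thm 1.6 (ii): the companion on `(Π^tp_X)^Θ`), the identification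
`ι(Π^tp_{X̲}) = T.tp T.PiXu`, and the UNIT-FREE rigidity identity with `σ₀ ∈ Π^tp_{X̲̲}`.
[cite: MochizukiEtTh2009, Cor 2.8(i) p.42] -/
theorem ofEmbedding_cor28_i_of_comm_reduced (hC : D.Compat) (hS : D.Sec2Hyps)
    (hstd : (ThetaOrbitData.ofEmbedding ε hC hS).IsStandard)
    (hα : ∀ g, ε.ι (α g) = Γ (ε.ι g)) (hβ : ∀ g, β (D.toTheta g) = D.toTheta (α g))
    (hXuι : (D.GtpXu l).map ε.ι = T.tp T.PiXu)
    (ΓΘ : (ThetaOrbitData.ofEmbedding ε hC hS).DeltaTheta ≃* (ThetaOrbitData.ofEmbedding ε hC hS).DeltaTheta)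
    (hind : (ThetaOrbitData.ofEmbedding ε hC hS).InducesOnTheta Γ ΓΘ)
    (hYmap : T.PiYddtp.map Γ.toMulEquiv.toMonoidHom = T.PiYddtp)
    (hYuu : (T.PiYddtp ⊓ T.tp T.PiXuu).map Γ.toMulEquiv.toMonoidHom = T.PiYddtp ⊓ T.tp T.PiXuu)
    (hXuumap : (T.tp T.PiXuu).map Γ.toMulEquiv.toMonoidHom = T.tp T.PiXuu)
    (hXumap : (T.tp T.PiXu).map Γ.toMulEquiv.toMonoidHom = T.tp T.PiXu)
    {σ₀ : D.PiTemp} (hσ₀ : σ₀ ∈ C.Huu)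
    (hη : ∀ (hΔ' : ∀ a, a ∈ D.DeltaTheta → β.symm a ∈ D.DeltaTheta)
        (hY : ∀ g, g ∈ D.GtpYdd → α g ∈ D.GtpYdd),
      haveI := hC.GtpYdd_normal
      ContH1Aut.autMap D.toTheta D.DeltaTheta α.symm β.symm (symm_toTheta_eq hβ) hΔ'
          (H := D.GtpYdd) (H' := D.GtpYdd) hY E.etaDd =
        ContH1.conj D.toTheta D.DeltaTheta σ₀ E.etaDd) :
    (ThetaOrbitData.ofEmbedding ε hC hS).IsStandardColl
        ((ThetaOrbitData.ofEmbedding ε hC hS).transport _ Γ hYmap ΓΘ (ThetaOrbitData.ofEmbedding ε hC hS).etaZMu2) ∧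
      (ThetaOrbitData.ofEmbedding ε hC hS).EqUpToRootOfUnity l _ (ThetaOrbitData.ofEmbedding ε hC hS).rootLZMu2
        ((ThetaOrbitData.ofEmbedding ε hC hS).transport _ Γ hYuu ΓΘ (ThetaOrbitData.ofEmbedding ε hC hS).rootLZMu2) ∧
      (ThetaOrbitData.ofEmbedding ε hC hS).EqUpToRootOfUnity 1 _ (ThetaOrbitData.ofEmbedding ε hC hS).etaZMu2
        ((ThetaOrbitData.ofEmbedding ε hC hS).transport _ Γ hYmap ΓΘ (ThetaOrbitData.ofEmbedding ε hC hS).etaZMu2) ∧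
      (ThetaOrbitData.ofEmbedding ε hC hS).EqUpToRootOfUnity 1 _ (ThetaOrbitData.ofEmbedding ε hC hS).etaLZMu2
        ((ThetaOrbitData.ofEmbedding ε hC hS).transport _ Γ hYmap ΓΘ
          (ThetaOrbitData.ofEmbedding ε hC hS).etaLZMu2) := by
  obtain ⟨hΔ, hΔ'⟩ := ε.stab_DeltaTheta_of_induces_comm hC hS hα hβ hind
  obtain ⟨hY, hY'⟩ := ε.stab_GtpYdd_of_comm hα hYmap
  obtain ⟨hU, hU'⟩ := ε.stab_Huu_of_comm hα hXuumap
  obtain ⟨hXu, hXu'⟩ := ε.stab_GtpXu_of_comm hXuι hα hXumap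
  exact ε.ofEmbedding_cor28_i_of_comm hC hS hstd hα hβ hΔ hΔ' hY hY' hXu hXu' hU hU' ΓΘ hind hYmap hYuu hσ₀
    (hη hΔ' hY)

/-! ## §4. The unit-carrying transport in `ThetaOrbitData` currency: transport = twist -/

open Classical in
/-- **Under UNIT-CARRYING rigidity the transported `η̈^{Θ,ℤ×μ₂}` is the TWIST of `η̈^{Θ,ℤ×μ₂}`** (abc-iut-L2-t2's
`ThetaOrbitData.twist`) by the function `κ` extending the transported representative `transport f_k` by `1` off
`Π^tp_Ÿ`: `(Γ, Γ_Θ)·η̈^{Θ,ℤ×μ₂} = twist κ η̈^{Θ,ℤ×μ₂}` — «up to multiplication by [the class of] a unit»; whether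
this twist is by a root of unity of the printed order is then a question about `[f_k]` alone.
[cite: MochizukiEtTh2009, Cor 2.8(i) p.42] -/
theorem ofEmbedding_transport_etaZMu2_eq_twist_of_unit (hC : D.Compat) (hS : D.Sec2Hyps)
    (hα : ∀ g, ε.ι (α g) = Γ (ε.ι g)) (hβ : ∀ g, β (D.toTheta g) = D.toTheta (α g))
    (hΔ : ∀ a, a ∈ D.DeltaTheta → β a ∈ D.DeltaTheta) (hΔ' : ∀ a, a ∈ D.DeltaTheta → β.symm a ∈ D.DeltaTheta)
    (hY : ∀ g, g ∈ D.GtpYdd → α g ∈ D.GtpYdd) (hY' : ∀ g, g ∈ D.GtpYdd → α.symm g ∈ D.GtpYdd)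
    (ΓΘ : (ThetaOrbitData.ofEmbedding ε hC hS).DeltaTheta ≃* (ThetaOrbitData.ofEmbedding ε hC hS).DeltaTheta)
    (hind : (ThetaOrbitData.ofEmbedding ε hC hS).InducesOnTheta Γ ΓΘ)
    (hYmap : T.PiYddtp.map Γ.toMulEquiv.toMonoidHom = T.PiYddtp)
    {σ₀ : D.PiTemp} (fk : ↥(contCocycles D.toTheta D.DeltaTheta D.GtpYdd))
    (hk : ∀ s : D.PiTemp, haveI := hC.GtpYdd_normal
      ContH1.conj D.toTheta D.DeltaTheta s (ContH1.mk fk.1 fk.2 : D.H1 D.GtpYdd) = ContH1.mk fk.1 fk.2)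
    (hη : haveI := hC.GtpYdd_normal
      ContH1Aut.autMap D.toTheta D.DeltaTheta α.symm β.symm (symm_toTheta_eq hβ) hΔ'
          (H := D.GtpYdd) (H' := D.GtpYdd) hY E.etaDd =
        ContH1.mk fk.1 fk.2 * ContH1.conj D.toTheta D.DeltaTheta σ₀ E.etaDd) :
    (ThetaOrbitData.ofEmbedding ε hC hS).transport _ Γ hYmap ΓΘ (ThetaOrbitData.ofEmbedding ε hC hS).etaZMu2 =
      (ThetaOrbitData.ofEmbedding ε hC hS).twist _
        (fun g : T.Gtp => haveI : ε.bot.Normal := ε.normal_bot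
          if h : g ∈ T.PiYddtp then ε.transport fk.1 ⟨g, h⟩ else 1)
        (ThetaOrbitData.ofEmbedding ε hC hS).etaZMu2 := by
  haveI := hC.GtpYdd_normal
  haveI : ε.bot.Normal := ε.normal_bot
  have hΘ := ε.symm_coeffOf_of_induces_comm hC hS hα hβ hΔ' ΓΘ hind
  have h := ε.image_orbitColl_eq_twist_of_unit hC hα hβ hΔ hΔ' hY hY' ΓΘ hΘ (ε.mem_PiYddtp_of_comm hα hY) fk hk hη
    (S := Set.univ) (fun _ _ => Set.mem_univ _) (fun _ _ => Set.mem_univ _)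
  refine h.trans ?_
  change _ = (fun c => (fun η : ↥T.PiYddtp → ε.Coeff => fun g : ↥T.PiYddtp => η g *
      (if h : (g : T.Gtp) ∈ T.PiYddtp then ε.transport fk.1 ⟨g, h⟩ else 1)) '' c) '' ε.orbitColl hC Set.univ
  congr 1
  funext c
  congr 1
  funext η
  funext g
  rw [dif_pos g.2]

end ThetaSetting.EtaleThetaData.DoubleUnderline.OrbitEmbedding

end Literature.AnabelianGeometry.EtaleTheta

end
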